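import Mathlib
import HarnessLib
import Summits.ABC.ABC.Theses.IneffectiveSubspace
import Literature.NumberTheory.DiophantineGeometry.AbcWave0

/-!
# Sketch (crux-ideate r1 k1) — crux stmt-ABC-1649 `TowerFourSubLiouville`

First-lemma signatures for the idea card `fourth-radical-binomial-thue` and the arithmetic
certificates of the β-engine autopsy (BarrierNotes-r1-k1.md). Everything here is a `def … : Prop`
(statements to be proved by a line) or a small `theorem` proved now.
-/

set_option linter.dupNamespace false

namespace Summit.ABC.ABC.Cruxes.TowerFourSubLiouville.Ideator1

open scoped BigOperators
open Literature.NumberTheory.DiophantineGeometry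
open Summit.ABC.ABC.Theses.IneffectiveSubspace

/-- The level-`n` tower inequality with exponent dial `A` (the route's `TowerIneq(n, A)`). -/
def TowerIneq (n : ℕ) (A : ℝ) : Prop :=
  ∀ ε : ℝ, 0 < ε → ∃ C : ℝ, 0 < C ∧ ∀ x y z : Fin n → ℕ, (∀ i, 0 < x i ∧ 0 < y i ∧ 0 < z i) →
    (∏ i, x i ^ (i.val + 1)) + (∏ i, y i ^ (i.val + 1)) = ∏ i, z i ^ (i.val + 1) →
    Nat.Coprime (∏ i, x i ^ (i.val + 1)) (∏ i, y i ^ (i.val + 1)) →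
    ((∏ i, z i ^ (i.val + 1) : ℕ) : ℝ) < C * ((∏ i, x i * y i * z i : ℕ) : ℝ) ^ (A + ε)

/-- The crux is literally `∃ A < 2, TowerIneq 4 A`. -/
theorem crux_iff_towerIneq : TowerFourSubLiouville ↔ ∃ A : ℝ, A < 2 ∧ TowerIneq 4 A := Iff.rfl

/-- The *fourth-power radical* `S₄(m) = ∏_p p^{⌈v_p(m)/4⌉}` — the least value of `x₀x₁x₂x₃` over all
representations `m = x₀ x₁² x₂³ x₃⁴` (per prime: `min {e₀+e₁+e₂+e₃ : e₀+2e₁+3e₂+4e₃ = v} = ⌈v/4⌉`).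
`S₄(m) ≥ rad m` and `S₄(m) ≥ m^{1/4}`. -/
def fourRad (m : ℕ) : ℕ := ∏ p ∈ m.primeFactors, p ^ ((m.factorization p + 3) / 4)

/-- NORMAL FORM of the level-4 inequality: `c < C(ε) · S₄(abc)^{A+ε}` on abc triples. -/
def FourRadBound (A : ℝ) : Prop :=
  ∀ ε : ℝ, 0 < ε → ∃ C : ℝ, 0 < C ∧ ∀ a b c : ℕ, IsABCTriple a b c →
    (c : ℝ) < C * (fourRad (a * b * c) : ℝ) ^ (A + ε)

/-- First lemma (i), provable now (multiplicativity + the per-prime minimum):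
`TowerIneq 4 A ↔ FourRadBound A` for `A ≥ 0`. Trivial end of the dial: `FourRadBound 2`
(`S₄(abc) ≥ (abc)^{1/4} ≥ (c²/2)^{1/4}`); the crux asks for any `A < 2`. -/
def NormalForm : Prop := ∀ A : ℝ, 0 ≤ A → (TowerIneq 4 A ↔ FourRadBound A)

/-- **C⁺ (the transfer target).** Uniform binomial quartic Thue inequality with saving `η`:
for coprime `vY, wZ` with `max(v,w) ≤ Z^η` and `Z` large, `|wZ⁴ − vY⁴| > Z^η`.
Equivalently: no coprime solutions of `wZ⁴ − vY⁴ = a` with `max(a,v,w) ≤ Z^η`, `Z ≥ Z₀`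
(a Hall-type power saving over Liouville's `|wZ⁴ − vY⁴| ≥ 1`, uniform in the coefficients). -/
def UniformBinomialQuartic (η : ℝ) : Prop :=
  ∃ Z₀ : ℕ, ∀ v w Y Z : ℕ, 0 < v → 0 < w → 0 < Y → Z₀ ≤ Z → Nat.Coprime (v * Y) (w * Z) →
    ((max v w : ℕ) : ℝ) ≤ (Z : ℝ) ^ η → w * Z ^ 4 ≠ v * Y ^ 4 →
    (Z : ℝ) ^ η < |((w * Z ^ 4 : ℕ) : ℝ) - ((v * Y ^ 4 : ℕ) : ℝ)|

/-- First lemma (ii) — the transfer, provable now by the `S₄` bookkeeping: if some `η > 0` saving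
holds then the crux holds (with `A = 2 − η/20`, say): a triple with `S₄(abc) ≤ c^{1/2+δ}` has its
smaller summand `a ≤ 2c^{4δ}` and `b = vY⁴`, `c = wZ⁴` with fourth-power-free `v, w ≤ 8c^{12δ}`. -/
def CruxOfUBQ : Prop := (∃ η : ℝ, 0 < η ∧ UniformBinomialQuartic η) → TowerFourSubLiouville

/-- Converse (so C⁺ is an honest equivalent, not a strengthening): an enemy `wZ⁴ − vY⁴ = a` with
`max(a,v,w) ≤ Z^η` is an abc triple with `c ≥ Z⁴` and `∏ xᵢyᵢzᵢ ≤ 2Z^{2+13η/4}` in its least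
representation, violating `TowerIneq 4 A` once `A + ε < 4/(2 + 13η/4)`. -/
def UBQOfCrux : Prop := TowerFourSubLiouville → ∃ η : ℝ, 0 < η ∧ UniformBinomialQuartic η

/-- Polynomial abc with exponent `κ` (ineffective constant). -/
def PolyABC (κ : ℝ) : Prop :=
  ∃ C : ℝ, 0 < C ∧ ∀ a b c : ℕ, IsABCTriple a b c → (c : ℝ) < C * ((rad a b c : ℕ) : ℝ) ^ κ

/-- Upstream sufficient condition (support, provable now; generalises the route's `AbcGivesTower`):
`rad(abc) ≤ ∏ xᵢyᵢzᵢ` for every representation, so `PolyABC κ → TowerIneq n κ` at every level. -/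
def PolyAbcGivesTower : Prop := ∀ κ : ℝ, 0 ≤ κ → PolyABC κ → ∀ n : ℕ, 1 ≤ n → TowerIneq n κ

/-- Hence any polynomial abc with exponent `< 2` closes the crux (much stronger than the crux). -/
def CruxOfPolyAbc : Prop := (∃ κ : ℝ, 0 ≤ κ ∧ κ < 2 ∧ PolyABC κ) → TowerFourSubLiouville

/-- … and so does a *strong window* at any level: `TowerIneq n A` with `A(n+6) < 2n` gives
`PolyABC (nA'/(n−3A'))` with exponent `< 2` (`A' = A + ε`, the route's `WindowGivesPolynomialAbc`
bookkeeping), hence the crux. -/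
def CruxOfStrongWindow : Prop :=
  (∃ n : ℕ, 1 ≤ n ∧ ∃ A : ℝ, 0 < A ∧ A * (n + 6) < 2 * n ∧ TowerIneq n A) → TowerFourSubLiouville

/-! ### Certificates for the β-engine autopsy (BarrierNotes-r1-k1.md)

On `X_n ⊂ (ℙ²)ⁿ` with `L = O(d₁,…,dₙ)` one has `Vol_X(d) ∝ (∏ dᵢ²)·Σᵢ i/dᵢ` (from
`h⁰(X,O(d)) = h⁰(ℙ,O(d)) − h⁰(ℙ,O(d−e))`, `e = (1,…,n)`, `H¹ = 0` on `(ℙ²)ⁿ`), whence for the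
last-factor boundary component `β(O(d), {xₙ=0})/dₙ = (σdₙ/3 + n/2)/(σdₙ + n)`,
`σ = Σ_{i<n} i/dᵢ ≥ 0`. -/

/-- The β-ratio of the last factor never exceeds `1/2` (it would have to exceed `1` to see a
Liouville-sharp enemy). -/
theorem betaRatio_le_half (σd n : ℝ) (hσ : 0 ≤ σd) (hn : 0 < n) :
    (σd / 3 + n / 2) / (σd + n) ≤ 1 / 2 := by
  rw [div_le_iff₀ (by linarith)]
  linarith

/-- Planner's cash-out `A = 1/(3(1−B)/n + Bt)` evaluated at the cap `B = 2/dₙ`, `dₙ = 3 − nt`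
(what `X_n` itself allows): the output is `A = n` identically — worse than the trivial `n/2`. -/
theorem cashout_at_Xn_cap (n t : ℝ) (hn : n ≠ 0) (hd : 3 - n * t ≠ 0) :
    1 / (3 * (1 - 2 / (3 - n * t)) / n + 2 / (3 - n * t) * t) = n := by
  have key : 3 * (1 - 2 / (3 - n * t)) / n + 2 / (3 - n * t) * t = 1 / n := by
    field_simp
    ring
  rw [key, one_div_one_div]

/-- Same cash-out at the absolute cap `B = 1/dₙ` (β = its pseudo-effective threshold, the best any
birational model could give): the output is exactly the trivial Liouville exponent `A = n/2`. -/
theorem cashout_at_tau_cap (n t : ℝ) (hn : n ≠ 0) (hd : 3 - n * t ≠ 0) :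
    1 / (3 * (1 - 1 / (3 - n * t)) / n + 1 / (3 - n * t) * t) = n / 2 := by
  have key : 3 * (1 - 1 / (3 - n * t)) / n + 1 / (3 - n * t) * t = 2 / n := by
    field_simp
    ring
  rw [key]
  field_simp

end Summit.ABC.ABC.Cruxes.TowerFourSubLiouville.Ideator1
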